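import Summits.RiemannHypothesis.RiemannHypothesis.Theorems.SpectralTraceHeckeSurrogateDefs
import Summits.RiemannHypothesis.RiemannHypothesis.Theorems.SpectralTraceWindowTracePrime2StubLogDerivDiff
import Summits.RiemannHypothesis.RiemannHypothesis.Theorems.SpectralTraceWindowTracePrime2StubZeroCount
import Literature.Uncategorized.GammaLowerBound
import Literature.NumberTheory.LFunctions.SelbergClassZeroCounting
import HarnessLib

/-!
# Good heights for a pair of surrogates — stub `stub_goodHeights`

Route `RiemannHypothesis/SpectralTrace`, crux `WindowTracePrime2` (stmt-RiemannHypothesis-11196),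
line `hecke-cusp-perturbation-surrogate`, registered stub **D** `stub_goodHeights`
(skeleton `Cruxes/WindowTracePrime2/Lines/hecke_cusp_perturbation_surrogate.lean`; vocabulary
`Theorems/SpectralTraceHeckeSurrogateDefs.lean`: `IsSurrogate`, `RightHalfPlaneControl`,
`ZeroCountBound`, `ZIdx`, `zval`; hypotheses `Literature.Uncategorized.GammaLowerBound`,
`Literature.Uncategorized.HorizontalLogDerivBound`).

For a PAIR `F, G` of surrogates controlled on a right half-plane and with polynomially bounded local
zero counts, and `σ > 1/2`: every unit interval `[t, t+1]` (`t ≥ 0`) contains a height `T` such that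
no zero of `F` or `G` has ordinate `±T` and on the horizontal segments `Im s = ±T`, `1-σ ≤ Re s ≤ σ`
one has `‖F'/F‖, ‖G'/G‖ ≤ C (1+t)^k`.

* `gh_count` — the POINTS TO AVOID of one surrogate at level `t`: the distinct zeros `ρ` with
  `|Im ρ - t| ≤ R + 1`, a finite set of size `≤ C(1+t)^k` (cover by unit windows; the distinct zeros of
  a window inject into its zeros-with-multiplicity `ρ ↦ ⟨ρ, 0⟩`, `ord_ρ F ≥ 1` as `F ≢ 0`).
* `gh_core` — Landau's lemma (`HorizontalLogDerivBound`) at the centre `c = σ_c + iτ`, `σ_c = 2n+1 ≥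
  max(σ₁, σ) + 1`, radius `R = 4(σ_c + σ)`: `M = exp(B + B X²)` from the order bound, `‖F(c)‖ ≥
  ½‖c(c-1)Γ_ℝ(c)‖ ≥ (q/2) e^{-|τ|}` from the right half-plane control and the Gamma lower bound, so
  `log(M/‖F(c)‖) = O((1+t)²)` and `‖F'/F(x+iτ)‖ ≤ C(1+t)²/δ` once the zeros with `|Im a - τ| ≤ R` are
  `δ`-separated from `τ`.
* `gh_one` — both heights `±T` for one surrogate (the symmetry `F(1-s) = F(s)` reflects ordinates, so
  the zeros near `-T` are `1 - ρ` for the avoided `ρ` near `T`).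
* `stub_goodHeights` — `Z = Z_F ∪ Z_G`, `Soundararajan2004.exists_height_far_from` gives `T ∈ [t, t+1]`
  at distance `≥ δ = 1/(2(#Z+1)) ≥ 1/poly(1+t)` from every avoided ordinate.

References: E. C. Titchmarsh, *The theory of the Riemann zeta-function* (1986), §3.9 Lemma α, §9.2
[Titchmarsh1986]; K. Soundararajan, *Degree 1 elements of the Selberg class*, Expo. Math. (2005), p. 2
[Soundararajan2002].
-/

noncomputable section

set_option linter.dupNamespace false

namespace Summit.RiemannHypothesis.RiemannHypothesis.Theorems.HeckeSurrogate

open Complex Filter Set MeasureTheory Metric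
open scoped Real Topology
open Literature.NumberTheory.LFunctions
open Literature.Uncategorized

/-- For an entire `F ≢ 0`, every zero has positive (finite) order of vanishing. [folklore] -/
theorem gh_order_pos {F : ℂ → ℂ} (hFd : Differentiable ℂ F) {s₀ : ℂ} (hs₀ : F s₀ ≠ 0) {ρ : ℂ}
    (hρ : F ρ = 0) : 0 < analyticOrderNatAt F ρ := by
  have htop : analyticOrderAt F ρ ≠ ⊤ := by
    intro h
    rw [analyticOrderAt_eq_top] at h
    have := (analyticOnNhd_univ_iff_differentiable.mpr hFd).eqOn_zero_of_preconnected_of_eventuallyEq_zero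
      isPreconnected_univ (mem_univ ρ) h
    exact hs₀ (this (mem_univ s₀))
  have hne : analyticOrderAt F ρ ≠ 0 := (hFd.analyticAt ρ).analyticOrderAt_ne_zero.2 hρ
  rw [pos_iff_ne_zero, ne_eq, ← Nat.cast_inj (R := ℕ∞), Nat.cast_analyticOrderNatAt htop,
    Nat.cast_zero]
  exact hne

/-- Leading-term domination `‖s(s-1)Γ_ℝ(s)‖ ≤ 2‖F(s)‖` on `Re s ≥ σ₁ ≥ 2` forces `F(s) ≠ 0` there
(`s(s-1)Γ_ℝ(s) ≠ 0` for `Re s > 1`). [folklore] -/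
theorem gh_ne_zero_of_control {F : ℂ → ℂ} {σ₁ : ℝ} (hσ₁ : 2 ≤ σ₁)
    (hdom : ∀ s : ℂ, σ₁ ≤ s.re → ‖s * (s - 1) * s.Gammaℝ‖ ≤ 2 * ‖F s‖) {s : ℂ} (hs : σ₁ ≤ s.re) :
    F s ≠ 0 := by
  intro h0
  have h1 := hdom s hs
  rw [h0, norm_zero, mul_zero] at h1
  exact polarFactor_ne_zero (by linarith) (norm_le_zero_iff.1 h1)

/-- **Points to avoid.** For an entire `F ≢ 0` with `ZeroCountBound F` and `R ≥ 0`: for `t ≥ 0` the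
distinct zeros `ρ` of `F` with `|Im ρ - t| ≤ R + 1` form a finite set of size `≤ C (1+t)^k` (cover
the ordinate range by the `2N₀+1` unit windows centred at `t - N₀ + j`, `N₀ = ⌈R+1⌉`; the distinct
zeros of a window inject into its zeros-with-multiplicity via `ρ ↦ ⟨ρ, 0⟩`, and each window carries
`≤ A(2+|t - N₀ + j|)^A ≤ A(2+3N₀)^A (1+t)^⌈A⌉` of those). [cite: Titchmarsh1986, §9.2] -/
theorem gh_count {F : ℂ → ℂ} (hFd : Differentiable ℂ F) {s₀ : ℂ} (hs₀ : F s₀ ≠ 0)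
    (hZ : ZeroCountBound F) {R : ℝ} (hR : 0 ≤ R) :
    ∃ (C : ℝ) (k : ℕ), 0 ≤ C ∧ ∀ t : ℝ, 0 ≤ t →
      {ρ : ℂ | F ρ = 0 ∧ |ρ.im - t| ≤ R + 1}.Finite ∧
        (({ρ : ℂ | F ρ = 0 ∧ |ρ.im - t| ≤ R + 1}.ncard : ℕ) : ℝ) ≤ C * (1 + t) ^ k := by
  classical
  obtain ⟨A, -, hA⟩ := hZ
  have hA0 : 0 ≤ A := by
    have h2 : (0 : ℝ) < (2 + |(0 : ℝ)|) ^ A := Real.rpow_pos_of_pos (by norm_num) _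
    exact nonneg_of_mul_nonneg_left ((Nat.cast_nonneg _).trans (hA 0).2) h2
  set N₀ : ℕ := ⌈R + 1⌉₊ with hN₀
  have hN₀R : R + 1 ≤ N₀ := Nat.le_ceil _
  have hN₀0 : (0 : ℝ) ≤ N₀ := N₀.cast_nonneg
  set k : ℕ := ⌈A⌉₊ with hk
  have hkA : A ≤ k := Nat.le_ceil _
  set L : ℝ := 2 + 3 * (N₀ : ℝ) with hL
  refine ⟨(2 * N₀ + 1) * (A * L ^ A), k, by positivity, fun t ht => ?_⟩
  -- the windows and their distinct zeros
  set W : ℕ → Set ℂ := fun j => zval '' {i : ZIdx F | |(zval i).im - (t - N₀ + j)| ≤ 1} with hW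
  have hWfin : ∀ j, (W j).Finite := fun j => (hA _).1.image _
  have hWcard : ∀ j, j < 2 * N₀ + 1 → ((W j).ncard : ℝ) ≤ A * L ^ A * (1 + t) ^ k := by
    intro j hj
    have hj' : (j : ℝ) ≤ 2 * N₀ := by exact_mod_cast Nat.lt_succ_iff.1 hj
    have hj0 : (0 : ℝ) ≤ j := j.cast_nonneg
    have h1 : ((W j).ncard : ℝ) ≤ ({i : ZIdx F | |(zval i).im - (t - N₀ + j)| ≤ 1}.ncard : ℝ) := by
      exact_mod_cast Set.ncard_image_le (hA _).1
    refine h1.trans ((hA _).2.trans ?_)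
    have hT : |t - N₀ + j| ≤ t + 3 * N₀ := by
      rw [abs_le]; constructor <;> linarith
    have hbase : 2 + |t - N₀ + j| ≤ L * (1 + t) := by
      have e : L * (1 + t) = 2 + 3 * N₀ + 2 * t + 3 * (N₀ * t) := by rw [hL]; ring
      rw [e]; nlinarith [mul_nonneg hN₀0 ht]
    have h1t : (1 : ℝ) ≤ 1 + t := by linarith
    have hL0 : 0 ≤ L := by positivity
    calc A * (2 + |t - ↑N₀ + ↑j|) ^ A ≤ A * (L * (1 + t)) ^ A :=
          mul_le_mul_of_nonneg_left (Real.rpow_le_rpow (by positivity) hbase hA0) hA0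
      _ = A * L ^ A * (1 + t) ^ A := by rw [Real.mul_rpow hL0 (by positivity)]; ring
      _ ≤ A * L ^ A * (1 + t) ^ (k : ℝ) :=
          mul_le_mul_of_nonneg_left (Real.rpow_le_rpow_of_exponent_le h1t hkA) (by positivity)
      _ = A * L ^ A * (1 + t) ^ k := by rw [Real.rpow_natCast]
  -- the cover
  set V : Finset ℂ := (Finset.range (2 * N₀ + 1)).biUnion fun j => (hWfin j).toFinset with hV
  have hsub : {ρ : ℂ | F ρ = 0 ∧ |ρ.im - t| ≤ R + 1} ⊆ ↑V := by
    rintro ρ ⟨h0, hρ⟩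
    rw [abs_le] at hρ
    obtain ⟨u, hu⟩ : ∃ u : ℝ, u = ρ.im - t + N₀ := ⟨_, rfl⟩
    have hu0 : 0 ≤ u := by rw [hu]; linarith
    have hu1 : u ≤ 2 * N₀ := by rw [hu]; linarith
    have hj1 : (⌊u⌋₊ : ℝ) ≤ u := Nat.floor_le hu0
    have hj2 : u < ⌊u⌋₊ + 1 := Nat.lt_floor_add_one u
    have hjN : ⌊u⌋₊ < 2 * N₀ + 1 := by
      rw [Nat.lt_succ_iff]
      exact_mod_cast hj1.trans hu1
    rw [Finset.mem_coe, hV, Finset.mem_biUnion]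
    refine ⟨⌊u⌋₊, Finset.mem_range.2 hjN, ?_⟩
    rw [Set.Finite.mem_toFinset]
    refine ⟨(⟨⟨ρ, h0⟩, ⟨0, gh_order_pos hFd hs₀ h0⟩⟩ : ZIdx F), ?_, rfl⟩
    show |ρ.im - (t - N₀ + (⌊u⌋₊ : ℕ))| ≤ 1
    rw [abs_le]; constructor <;> linarith
  have hfin : {ρ : ℂ | F ρ = 0 ∧ |ρ.im - t| ≤ R + 1}.Finite := V.finite_toSet.subset hsub
  refine ⟨hfin, ?_⟩
  have h1 : {ρ : ℂ | F ρ = 0 ∧ |ρ.im - t| ≤ R + 1}.ncard ≤ V.card := by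
    simpa using Set.ncard_le_ncard hsub V.finite_toSet
  have h2 : V.card ≤ ∑ j ∈ Finset.range (2 * N₀ + 1), (hWfin j).toFinset.card :=
    Finset.card_biUnion_le
  have h3 : ∀ j, ((hWfin j).toFinset.card : ℝ) = ((W j).ncard : ℝ) := fun j => by
    rw [Set.ncard_eq_toFinset_card _ (hWfin j)]
  calc (({ρ : ℂ | F ρ = 0 ∧ |ρ.im - t| ≤ R + 1}.ncard : ℕ) : ℝ) ≤ (V.card : ℝ) := by
        exact_mod_cast h1
    _ ≤ ((∑ j ∈ Finset.range (2 * N₀ + 1), (hWfin j).toFinset.card : ℕ) : ℝ) := by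
        exact_mod_cast h2
    _ = ∑ j ∈ Finset.range (2 * N₀ + 1), ((W j).ncard : ℝ) := by
        push_cast
        exact Finset.sum_congr rfl fun j _ => h3 j
    _ ≤ ∑ j ∈ Finset.range (2 * N₀ + 1), A * L ^ A * (1 + t) ^ k :=
        Finset.sum_le_sum fun j hj => hWcard j (Finset.mem_range.1 hj)
    _ = (2 * N₀ + 1) * (A * L ^ A) * (1 + t) ^ k := by
        rw [Finset.sum_const, Finset.card_range, nsmul_eq_mul]; push_cast; ring

set_option maxHeartbeats 400000 in
/-- **Landau's bound at one height** (one surrogate, one height `τ` with `|τ| ≤ t+1`). With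
`σ_c = 2n+1`, `n = ⌈max(σ₁, σ)⌉`, and `R = 4(σ_c + σ)`: if every zero `a` of `F` with `|Im a - τ| ≤ R`
has `|Im a - τ| ≥ δ` (`0 < δ ≤ 1`), then `‖F'/F(x + iτ)‖ ≤ C (1+t)²/δ` for `1 - σ ≤ x ≤ σ` — the
Landau–Titchmarsh lemma `HorizontalLogDerivBound` at the centre `c = σ_c + iτ` (`|x - σ_c| ≤ R/4`)
with `M = exp(B + B X²)`, `X = σ_c + 1 + 2R + t`, from the order-`≤ 1` bound, and
`‖F(c)‖ ≥ ½‖c(c-1)Γ_ℝ(c)‖ ≥ (q/2) e^{-|τ|}` from the right half-plane control and the Gamma lower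
bound, so that `log(M/‖F(c)‖) + 1 ≤ P (1+t)²`; finally `1/δ + 1/R ≤ 2/δ`.
[cite: Titchmarsh1986, §3.9 Lemma α] -/
theorem gh_core (hΓ : GammaLowerBound) (hH : HorizontalLogDerivBound) {F : ℂ → ℂ}
    (hF : IsSurrogate F) (hRF : RightHalfPlaneControl F) {σ : ℝ} (hσ : 1 / 2 < σ) :
    ∃ R C : ℝ, 1 ≤ R ∧ 0 ≤ C ∧ ∀ t τ δ : ℝ, 0 ≤ t → |τ| ≤ t + 1 → 0 < δ → δ ≤ 1 →
      (∀ a : ℂ, F a = 0 → |a.im - τ| ≤ R → δ ≤ |a.im - τ|) →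
      ∀ x : ℝ, x ∈ Icc (1 - σ) σ → ‖logDeriv F (x + τ * I)‖ ≤ C * (1 + t) ^ 2 / δ := by
  obtain ⟨K, hK0, hH⟩ := hH
  obtain ⟨σ₁, -, hσ₁, -, hdom, -⟩ := hRF
  have hFd : Differentiable ℂ F := hF.1
  obtain ⟨B, hB0, hB⟩ := zc_log_norm_le hF.2.1
  -- the abscissa of the centres `σ_c = 2n + 1`, `n ≥ max σ₁ σ`, `n ≥ 1`
  obtain ⟨n, hn1, hnσ⟩ : ∃ n : ℕ, 1 ≤ n ∧ max σ₁ σ ≤ n :=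
    ⟨⌈max σ₁ σ⌉₊, Nat.ceil_pos.2 (lt_of_lt_of_le (by linarith) (le_max_left _ _)), Nat.le_ceil _⟩
  have hn0 : (0 : ℝ) ≤ n := n.cast_nonneg
  have hσ₁n : σ₁ ≤ n := (le_max_left _ _).trans hnσ
  have hσn : σ ≤ n := (le_max_right _ _).trans hnσ
  obtain ⟨q, hq0, hq⟩ := zc_centre_lower hΓ hn1
  obtain ⟨σc, hσc⟩ : ∃ σc : ℝ, σc = 2 * n + 1 := ⟨_, rfl⟩
  have hσc1 : σ₁ ≤ σc := by rw [hσc]; linarith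
  have hσc0 : 0 < σc := by linarith
  obtain ⟨R, hR⟩ : ∃ R : ℝ, R = 4 * (σc + σ) := ⟨_, rfl⟩
  have hR1 : 1 ≤ R := by rw [hR]; linarith
  have hR0 : 0 < R := by linarith
  obtain ⟨X₀, hX₀⟩ : ∃ X₀ : ℝ, X₀ = σc + 1 + 2 * R := ⟨_, rfl⟩
  have hX₀1 : 1 ≤ X₀ := by rw [hX₀]; linarith
  obtain ⟨P, hP⟩ : ∃ P : ℝ, P = B + B * X₀ ^ 2 + |Real.log (q / 2)| + 3 := ⟨_, rfl⟩
  have hP0 : 0 ≤ P := by rw [hP]; positivity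
  refine ⟨R, 2 * K * P, hR1, by positivity, fun t τ δ ht hτ hδ0 hδ1 hsep x hx => ?_⟩
  set c : ℂ := 2 * (n : ℂ) + 1 + τ * I with hc
  have hcre : c.re = σc := by rw [hσc]; simp [hc]
  have hcim : c.im = τ := by simp [hc]
  have hFc : F c ≠ 0 := gh_ne_zero_of_control hσ₁ hdom (by rw [hcre]; exact hσc1)
  -- the bound `M` on the big disc
  set M : ℝ := Real.exp (B + B * (X₀ + t) ^ 2) with hM
  have hMbd : ∀ z ∈ closedBall c (2 * R), ‖F z‖ ≤ M := by
    intro z hz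
    rw [mem_closedBall, dist_eq_norm] at hz
    have hcn : ‖c‖ ≤ σc + (t + 1) := by
      calc ‖c‖ ≤ |c.re| + |c.im| := Complex.norm_le_abs_re_add_abs_im c
        _ ≤ σc + (t + 1) := by rw [hcre, hcim, abs_of_pos hσc0]; linarith
    have hzn : ‖z‖ ≤ X₀ + t := by
      calc ‖z‖ = ‖(z - c) + c‖ := by rw [sub_add_cancel]
        _ ≤ ‖z - c‖ + ‖c‖ := norm_add_le _ _
        _ ≤ X₀ + t := by rw [hX₀]; linarith
    have hlog := hB (X₀ + t) z hzn
    rcases eq_or_ne (F z) 0 with h0 | h0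
    · rw [h0, norm_zero]; exact (Real.exp_pos _).le
    · calc ‖F z‖ = Real.exp (Real.log ‖F z‖) := (Real.exp_log (norm_pos_iff.2 h0)).symm
        _ ≤ M := Real.exp_le_exp.2 hlog
  -- separation in the form consumed by `HorizontalLogDerivBound`
  have hsep' : ∀ a : ℂ, F a = 0 → ‖a - c‖ ≤ R → δ ≤ |a.im - c.im| := by
    intro a h0 ha
    rw [hcim]
    refine hsep a h0 ?_
    calc |a.im - τ| = |(a - c).im| := by rw [sub_im, hcim]
      _ ≤ ‖a - c‖ := Complex.abs_im_le_norm _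
      _ ≤ R := ha
  have hxc : |x - c.re| ≤ R / 4 := by
    rw [hcre, hR, abs_le]
    obtain ⟨hx1, hx2⟩ := hx
    constructor <;> linarith
  have hmain := hH F hFd c R δ M hR0 hδ0 hFc hMbd hsep' x hxc
  rw [hcim] at hmain
  refine hmain.trans ?_
  -- the centre: `log ‖F c‖ ≥ log (q/2) - |τ|`
  have hFc_pos : 0 < ‖F c‖ := norm_pos_iff.2 hFc
  have hlow : Real.log (q / 2) - (t + 1) ≤ Real.log ‖F c‖ := by
    have h1 := hdom c (by rw [hcre]; exact hσc1)
    have h2 : q * Real.exp (-|τ|) ≤ ‖c * (c - 1) * c.Gammaℝ‖ := hq τ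
    have h3 : q / 2 * Real.exp (-|τ|) ≤ ‖F c‖ := by linarith
    have h4 := Real.log_le_log (by positivity) h3
    rw [Real.log_mul (by positivity) (Real.exp_pos _).ne', Real.log_exp] at h4
    linarith
  have hL : Real.log (M / ‖F c‖) + 1 ≤ P * (1 + t) ^ 2 := by
    rw [Real.log_div (Real.exp_pos _).ne' hFc_pos.ne', Real.log_exp]
    have h1t : (1 : ℝ) ≤ (1 + t) ^ 2 := by nlinarith
    have hXt : (X₀ + t) ^ 2 ≤ X₀ ^ 2 * (1 + t) ^ 2 := by
      rw [← mul_pow]; exact pow_le_pow_left₀ (by positivity) (by nlinarith) 2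
    have e1 : B ≤ B * (1 + t) ^ 2 := le_mul_of_one_le_right hB0 h1t
    have e2 : B * (X₀ + t) ^ 2 ≤ B * X₀ ^ 2 * (1 + t) ^ 2 := by
      rw [mul_assoc]; exact mul_le_mul_of_nonneg_left hXt hB0
    have e3 : |Real.log (q / 2)| ≤ |Real.log (q / 2)| * (1 + t) ^ 2 :=
      le_mul_of_one_le_right (abs_nonneg _) h1t
    have e4 : t + 2 ≤ 3 * (1 + t) ^ 2 := by nlinarith
    have e5 : -Real.log ‖F c‖ ≤ |Real.log (q / 2)| + (t + 1) := by
      linarith [neg_le_abs (Real.log (q / 2))]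
    have e6 : P * (1 + t) ^ 2 = B * (1 + t) ^ 2 + B * X₀ ^ 2 * (1 + t) ^ 2 +
        |Real.log (q / 2)| * (1 + t) ^ 2 + 3 * (1 + t) ^ 2 := by rw [hP]; ring
    linarith
  -- `1/δ + 1/R ≤ 2/δ`
  have hinv : 1 / δ + 1 / R ≤ 2 / δ := by
    have h1 : 1 / R ≤ 1 := by rw [div_le_one hR0]; exact hR1
    have h2 : 1 ≤ 1 / δ := by rw [le_div_iff₀ hδ0]; linarith
    have h3 : 2 / δ = 1 / δ + 1 / δ := by ring
    linarith
  have hinv0 : 0 ≤ 1 / δ + 1 / R := by positivity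
  calc K * (Real.log (M / ‖F c‖) + 1) * (1 / δ + 1 / R)
      ≤ K * (P * (1 + t) ^ 2) * (1 / δ + 1 / R) :=
        mul_le_mul_of_nonneg_right (mul_le_mul_of_nonneg_left hL hK0.le) hinv0
    _ ≤ K * (P * (1 + t) ^ 2) * (2 / δ) := mul_le_mul_of_nonneg_left hinv (by positivity)
    _ = 2 * K * P * (1 + t) ^ 2 / δ := by ring

/-- **One surrogate, both heights.** For `t ≥ 0` there is a finite set `Z ⊂ ℂ` of `≤ C(1+t)^k` points
(the distinct zeros `ρ` of `F` with `|Im ρ - t| ≤ R + 1`) such that for every height `T ∈ [t, t+1]`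
that is `δ`-far from the ordinates of `Z` (`0 < δ ≤ 1`): no zero of `F` has ordinate `±T`, and
`‖F'/F(x ± iT)‖ ≤ C(1+t)^k/δ` for `1-σ ≤ x ≤ σ` (for `-T` through the symmetry `F(1-s) = F(s)`:
the zeros near `-T` are the points `1 - ρ`, `ρ` an avoided zero near `T`). [cite: Titchmarsh1986, §9.2] -/
theorem gh_one (hΓ : GammaLowerBound) (hH : HorizontalLogDerivBound) {F : ℂ → ℂ}
    (hF : IsSurrogate F) (hRF : RightHalfPlaneControl F) (hZF : ZeroCountBound F) {σ : ℝ}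
    (hσ : 1 / 2 < σ) :
    ∃ (C : ℝ) (k : ℕ), 0 ≤ C ∧ ∀ t : ℝ, 0 ≤ t → ∃ Z : Finset ℂ, (Z.card : ℝ) ≤ C * (1 + t) ^ k ∧
      ∀ T : ℝ, T ∈ Icc t (t + 1) → ∀ δ : ℝ, 0 < δ → δ ≤ 1 → (∀ u ∈ Z, δ ≤ |T - u.im|) →
        (∀ s : ℂ, F s = 0 → s.im ≠ T ∧ s.im ≠ -T) ∧
        ∀ x : ℝ, x ∈ Icc (1 - σ) σ →
          ‖logDeriv F (x + T * I)‖ ≤ C * (1 + t) ^ k / δ ∧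
          ‖logDeriv F (x + (-T : ℝ) * I)‖ ≤ C * (1 + t) ^ k / δ := by
  obtain ⟨R, C₂, hR1, hC₂0, hcore⟩ := gh_core hΓ hH hF hRF hσ
  obtain ⟨σ₁, -, hσ₁, -, hdom, -⟩ := hRF
  have hs₀ : F (σ₁ : ℂ) ≠ 0 := gh_ne_zero_of_control hσ₁ hdom (by simp)
  obtain ⟨C₁, k₁, hC₁0, hcount⟩ := gh_count hF.1 hs₀ hZF (show (0 : ℝ) ≤ R by linarith)
  have hFE : ∀ s : ℂ, F (1 - s) = F s := hF.2.2.1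
  refine ⟨max C₁ C₂, max k₁ 2, hC₁0.trans (le_max_left _ _), fun t ht => ?_⟩
  obtain ⟨hfin, hcard⟩ := hcount t ht
  have h1t : (1 : ℝ) ≤ 1 + t := by linarith
  have hmono : ∀ (C' : ℝ) (k' : ℕ), C' ≤ max C₁ C₂ → k' ≤ max k₁ 2 → 0 ≤ C' →
      C' * (1 + t) ^ k' ≤ max C₁ C₂ * (1 + t) ^ (max k₁ 2) := fun C' k' hC hk hC0 =>
    mul_le_mul hC (pow_le_pow_right₀ h1t hk) (by positivity) (hC0.trans hC)
  refine ⟨hfin.toFinset, ?_, fun T hT δ hδ0 hδ1 hfar => ?_⟩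
  · rw [← Set.ncard_eq_toFinset_card _ hfin]
    exact hcard.trans (hmono C₁ k₁ (le_max_left _ _) (le_max_left _ _) hC₁0)
  have hmem : ∀ ρ : ℂ, F ρ = 0 → |ρ.im - t| ≤ R + 1 → δ ≤ |T - ρ.im| := fun ρ h0 h1 =>
    hfar ρ (by rw [Set.Finite.mem_toFinset]; exact ⟨h0, h1⟩)
  obtain ⟨hT1, hT2⟩ := hT
  have hC₂le : C₂ * (1 + t) ^ 2 / δ ≤ max C₁ C₂ * (1 + t) ^ (max k₁ 2) / δ :=
    div_le_div_of_nonneg_right (hmono C₂ 2 (le_max_right _ _) (le_max_right _ _) hC₂0) hδ0.le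
  refine ⟨fun s hs => ⟨fun h => ?_, fun h => ?_⟩, fun x hx => ⟨?_, ?_⟩⟩
  · have := hmem s hs (by rw [h, abs_le]; constructor <;> linarith)
    rw [h, sub_self, abs_zero] at this
    linarith
  · have him : (1 - s).im = T := by simp [h]
    have := hmem (1 - s) (by rw [hFE]; exact hs) (by rw [him, abs_le]; constructor <;> linarith)
    rw [him, sub_self, abs_zero] at this
    linarith
  · refine (hcore t T δ ht (by rw [abs_of_nonneg (by linarith)]; linarith) hδ0 hδ1 ?_ x hx).trans
      hC₂le
    intro a h0 ha
    rw [abs_le] at ha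
    have := hmem a h0 (by rw [abs_le]; constructor <;> linarith)
    rwa [abs_sub_comm] at this
  · refine (hcore t (-T) δ ht (by rw [abs_neg, abs_of_nonneg (by linarith)]; linarith) hδ0 hδ1 ?_
      x hx).trans hC₂le
    intro a h0 ha
    rw [sub_neg_eq_add, abs_le] at ha
    have him : (1 - a).im = -a.im := by simp
    have := hmem (1 - a) (by rw [hFE]; exact h0) (by rw [him, abs_le]; constructor <;> linarith)
    rw [him, sub_neg_eq_add, add_comm] at this
    rwa [sub_neg_eq_add]

/-- **`stub_goodHeights`** (registered stub D of the line `hecke-cusp-perturbation-surrogate`, crux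
stmt-RiemannHypothesis-11196): good heights for a PAIR of controlled surrogates. Every `[t, t+1]`
(`t ≥ 0`) contains `T` such that no zero of `F` or `G` has ordinate `±T` and on the horizontal
segments `Im s = ±T`, `1-σ ≤ Re s ≤ σ`: `‖F'/F‖, ‖G'/G‖ ≤ C (1+t)^k`. With the avoided sets
`Z_F(t), Z_G(t)` of `gh_one` (`#Z ≤ C₀(1+t)^{k₀}` each), `Soundararajan2004.exists_height_far_from`
supplies `T ∈ [t, t+1]` at distance `≥ δ = 1/(2(#(Z_F ∪ Z_G) + 1))` from every avoided ordinate, and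
`1/δ ≤ 2(2C₀ + 1)(1+t)^{k₀}`. [cite: Titchmarsh1986, §9.2] -/
theorem stub_goodHeights :
    GammaLowerBound → HorizontalLogDerivBound →
      ∀ F G : ℂ → ℂ, IsSurrogate F → IsSurrogate G →
        RightHalfPlaneControl F → RightHalfPlaneControl G → ZeroCountBound F → ZeroCountBound G →
        ∀ σ : ℝ, 1 / 2 < σ →
          ∃ (C : ℝ) (k : ℕ), ∀ t : ℝ, 0 ≤ t → ∃ T ∈ Set.Icc t (t + 1),
            (∀ s : ℂ, F s = 0 → s.im ≠ T ∧ s.im ≠ -T) ∧ (∀ s : ℂ, G s = 0 → s.im ≠ T ∧ s.im ≠ -T) ∧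
            ∀ x : ℝ, x ∈ Set.Icc (1 - σ) σ →
              ‖logDeriv F (x + T * I)‖ ≤ C * (1 + t) ^ k ∧
              ‖logDeriv F (x + (-T : ℝ) * I)‖ ≤ C * (1 + t) ^ k ∧
              ‖logDeriv G (x + T * I)‖ ≤ C * (1 + t) ^ k ∧
              ‖logDeriv G (x + (-T : ℝ) * I)‖ ≤ C * (1 + t) ^ k := by
  intro hΓ hH F G hF hG hRF hRG hZF hZG σ hσ
  classical
  obtain ⟨CF, kF, hCF0, hF1⟩ := gh_one hΓ hH hF hRF hZF hσ
  obtain ⟨CG, kG, hCG0, hG1⟩ := gh_one hΓ hH hG hRG hZG hσ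
  set C₀ : ℝ := max CF CG with hC₀
  set k₀ : ℕ := max kF kG with hk₀
  have hC₀0 : 0 ≤ C₀ := hCF0.trans (le_max_left _ _)
  refine ⟨2 * C₀ * (2 * C₀ + 1), k₀ + k₀, fun t ht => ?_⟩
  obtain ⟨ZF, hZFc, hF2⟩ := hF1 t ht
  obtain ⟨ZG, hZGc, hG2⟩ := hG1 t ht
  obtain ⟨T, hT, hfar⟩ := Soundararajan2004.exists_height_far_from (ZF ∪ ZG) t
  obtain ⟨N, hN⟩ : ∃ N : ℝ, N = ((ZF ∪ ZG).card : ℝ) := ⟨_, rfl⟩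
  obtain ⟨δ, hδ⟩ : ∃ δ : ℝ, δ = 1 / (2 * (N + 1)) := ⟨_, rfl⟩
  have hN0 : 0 ≤ N := by rw [hN]; exact Nat.cast_nonneg _
  have hδ0 : 0 < δ := by rw [hδ]; positivity
  have hδ1 : δ ≤ 1 := by rw [hδ, div_le_one (by positivity)]; linarith
  have hfar' : ∀ u ∈ ZF ∪ ZG, δ ≤ |T - u.im| := fun u hu => by rw [hδ, hN]; exact hfar u hu
  have h1t : (1 : ℝ) ≤ 1 + t := by linarith
  have hpow : ∀ k', k' ≤ k₀ → (1 + t) ^ k' ≤ (1 + t) ^ k₀ := fun k' hk => pow_le_pow_right₀ h1t hk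
  have hNle : N ≤ 2 * C₀ * (1 + t) ^ k₀ := by
    have h1 : N ≤ ZF.card + ZG.card := by rw [hN]; exact_mod_cast Finset.card_union_le ZF ZG
    have h2 : (ZF.card : ℝ) ≤ C₀ * (1 + t) ^ k₀ :=
      hZFc.trans (mul_le_mul (le_max_left _ _) (hpow kF (le_max_left _ _)) (by positivity) hC₀0)
    have h3 : (ZG.card : ℝ) ≤ C₀ * (1 + t) ^ k₀ :=
      hZGc.trans (mul_le_mul (le_max_right _ _) (hpow kG (le_max_right _ _)) (by positivity) hC₀0)
    linarith
  have key : ∀ (C' : ℝ) (k' : ℕ), 0 ≤ C' → C' ≤ C₀ → k' ≤ k₀ →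
      C' * (1 + t) ^ k' / δ ≤ 2 * C₀ * (2 * C₀ + 1) * (1 + t) ^ (k₀ + k₀) := by
    intro C' k' hC'0 hC' hk'
    have hinvδ : C' * (1 + t) ^ k' / δ = C' * (1 + t) ^ k' * (2 * (N + 1)) := by
      rw [hδ]; field_simp
    rw [hinvδ, pow_add]
    have h1 : C' * (1 + t) ^ k' ≤ C₀ * (1 + t) ^ k₀ :=
      mul_le_mul hC' (hpow k' hk') (by positivity) hC₀0
    have hp1 : (1 : ℝ) ≤ (1 + t) ^ k₀ := one_le_pow₀ h1t
    have h2 : 2 * (N + 1) ≤ 2 * (2 * C₀ + 1) * (1 + t) ^ k₀ := by nlinarith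
    calc C' * (1 + t) ^ k' * (2 * (N + 1))
        ≤ C₀ * (1 + t) ^ k₀ * (2 * (2 * C₀ + 1) * (1 + t) ^ k₀) :=
          mul_le_mul h1 h2 (by positivity) (by positivity)
      _ = 2 * C₀ * (2 * C₀ + 1) * ((1 + t) ^ k₀ * (1 + t) ^ k₀) := by ring
  obtain ⟨hFz, hFb⟩ := hF2 T hT δ hδ0 hδ1 (fun u hu => hfar' u (Finset.mem_union_left _ hu))
  obtain ⟨hGz, hGb⟩ := hG2 T hT δ hδ0 hδ1 (fun u hu => hfar' u (Finset.mem_union_right _ hu))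
  refine ⟨T, hT, hFz, hGz, fun x hx => ?_⟩
  obtain ⟨hF3, hF4⟩ := hFb x hx
  obtain ⟨hG3, hG4⟩ := hGb x hx
  exact ⟨hF3.trans (key CF kF hCF0 (le_max_left _ _) (le_max_left _ _)),
    hF4.trans (key CF kF hCF0 (le_max_left _ _) (le_max_left _ _)),
    hG3.trans (key CG kG hCG0 (le_max_right _ _) (le_max_right _ _)),
    hG4.trans (key CG kG hCG0 (le_max_right _ _) (le_max_right _ _))⟩

end Summit.RiemannHypothesis.RiemannHypothesis.Theorems.HeckeSurrogate

end
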